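import Summits.QuantumFields.YangMills.Theorems.VirialFluxGapAnchorSliceCovering
import Summits.QuantumFields.YangMills.Theorems.VirialFluxGapRingTreeGaugeZeroSet
import Summits.QuantumFields.YangMills.Theorems.VirialFluxGapFixOrbitSeparation
import Summits.QuantumFields.YangMills.Theorems.VirialFluxGapRingReferenceZero
import HarnessLib

/-!
# Tubes of the anchor slice COVER a metric neighbourhood of the zero set on `X_fix` — the `hfloor` glue of the DIRECT Laplace road to
# ⟨stmt-QuantumFields-24204⟩ `VirialFluxGap.SharpTwistedLaplace` (item (c)∕(d) junction)

Helper module (free-hands work of width seat ym-line-sfw-p2-w2 g50, cell ym-idea-1; `--supports 24204`), in the letters of the tree-gauged ring space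
`X_fix = (OffIdx L → SU2) × ((Fin (2L−1) → GaugeConfig 3 L SU2) × (Site 3 L → SU2))` (✓`VirialFluxGapFixGaugeAction`, ✓`FixSplit.FixSpace`).
✓`QuantitativeLaplace.ringDeficit_fix_floor` bounds `F_fix` from below OFF the set of points `x` whose squared chordal ring distance
`D(ι x, ι x′)` to some zero `x′` of `F_fix` is `< ρ`; this file shows that every such `x` is, after a CONSTANT gauge transformation, a point of the
ANCHOR SLICE with all coordinates uniformly close to the base ring `Q_s` of some sign class `s`:
* §1 per-coordinate control by `D`: every link ∕ site coordinate satisfies `‖su2Quat(x_c) − su2Quat(x′_c)‖² ≤ D(ι x, ι x′)`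
  (✓`norm_sq_le_timeCoupling_deficit`, ✓`re_trace_su2Rep_mul_inv_eq_norm`);
* §2 ★★ `exists_conj_anchorSlice_of_ringDistSq_lt` — `L ≥ 2`, `z k₀ = true`, reference data `(λ, N₀, C₀)` with `su2Quat C₀ = ιω_C`, `su2Quat N₀ = ιω_N`
  (`ω_C ⊥ ω_N`, `ιω_× = ιω_C ιω_N`); if `x′` is a zero of `F_fix` (✓`ringDeficit_treeGauge_eq_zero_iff`: `x′ = k′·Q_s`) and `D(ι x, ι x′) < ρ ≤ 1/1600`,
  then for some sign class `s`, constant `k ∈ SU(2)` and slice coordinates `t, b₁, b₂` (`|t| < π/2`, `|sin t| ≤ √ρ`, `b₁² + b₂² ≤ 225ρ`):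
  the seam anchor of `k·x` is `seamSlice ω_C C₀ t`, its link anchor (the wrap link `((−1,−1,−1), k₀)` of slice `0`) is
  `linkSlice ω_N ω_× (centreElem(s k₀)·N₀) b₁ b₂`, and EVERY coordinate of `k·x` is within `81√ρ` (in `su2Quat` norm) of the corresponding coordinate of
  `Q_s = (combFlat w_s ; λ·C₀)` — so `x` lies in the tube `SU(2)·σ_s(window)` of ✓`FixSplit.fixSlice` as soon as the window radius dominates these
  coordinate bounds (assembly item (d)).
Everything here is PROVED; no definitions, no named facts (namespace `Summit.QuantumFields.YangMills.Theorems.VirialFluxGap.AnchorSlice`).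

HONEST FRAMING: bookkeeping; ⟨24204⟩, ⟨24319⟩, ⟨22884⟩ and every rung stay OPEN; the Yang–Mills mass gap (Clay) is NOT touched; no summit is proved by a line.

## References
* G. E. Bredon, *Introduction to Compact Transformation Groups* (1972), Ch. II §§4–5 (tubes are neighbourhoods of the orbit). [Bredon1972]
-/

set_option autoImplicit false

noncomputable section

open scoped Quaternion RealInnerProductSpace BigOperators
open NormedSpace
open Literature.MathematicalPhysics.QuantumFieldTheory hiding SU2 su2Quat_mul
open Literature.MathematicalPhysics.QuantumLattice
open Literature.MathematicalPhysics.QuantumFieldTheory.Balaban1983to89.T4HaarSU2Translate (su2Quat_mul)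
open Literature.MathematicalPhysics.QuantumFieldTheory.Balaban1983to89.T4WilsonLinkAffine (su2Quat_inv)
open Literature.MathematicalPhysics.QuantumFieldTheory.Balaban1983to89.T4HaarSU2ExpChart
open Summit.QuantumFields.YangMills.Theorems.FemtoTransferGap
open Summit.QuantumFields.YangMills.Theorems.FemtoTransferGap.TT
open Summit.QuantumFields.YangMills.Theorems.FemtoTransferGap.TwoLattice
open Summit.QuantumFields.YangMills.Theorems.FemtoTransferGap.TwoLattice.Flat
open Summit.QuantumFields.YangMills.Theorems.ToronValleyVolume.Lojasiewicz
open Summit.QuantumFields.YangMills.Theorems.TwistEaterVolume.Quadratic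
open Summit.QuantumFields.YangMills.Theorems.VirialFluxGap.RingDeficit
open Summit.QuantumFields.YangMills.Theorems.QuantitativeLaplace (not_treeEdge_wrap su2Quat_centreElem)
open Summit.QuantumFields.YangMills.Theorems.FemtoTransferGap.TwoLattice.ConstTube (re_trace_su2Rep_mul_inv_eq_norm)

namespace Summit.QuantumFields.YangMills.Theorems.VirialFluxGap.AnchorSlice

variable {L : ℕ} [NeZero L]

/-! ## §1 Per-coordinate control by the squared chordal ring distance -/

/-- The squared chordal ring distance on `X_fix` (the sum of ✓`ringDeficit_fix_floor`) dominates every LINK coordinate. [folklore] -/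
theorem norm_sq_link_le_ringDistSq (x x' : (OffIdx L → SU2) × ((Fin (2 * L - 1) → GaugeConfig 3 L SU2) × (Site 3 L → SU2)))
    (i : Fin (2 * L - 1 + 1)) (e : Edge 3 L) :
    ‖su2Quat ((Fin.cons (glue x.1) x.2.1 : Fin (2 * L - 1 + 1) → GaugeConfig 3 L SU2) i e) -
        su2Quat ((Fin.cons (glue x'.1) x'.2.1 : Fin (2 * L - 1 + 1) → GaugeConfig 3 L SU2) i e)‖ ^ 2 ≤
      (∑ i : Fin (2 * L - 1 + 1), (6 * (L : ℝ) ^ 3 - timeCoupling su2Rep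
        ((Fin.cons (glue x.1) x.2.1 : Fin (2 * L - 1 + 1) → GaugeConfig 3 L SU2) i)
        ((Fin.cons (glue x'.1) x'.2.1 : Fin (2 * L - 1 + 1) → GaugeConfig 3 L SU2) i))) +
        ∑ y : Site 3 L, (2 - ((su2Rep (x.2.2 y * (x'.2.2 y)⁻¹)).trace).re) := by
  have h1 := norm_sq_le_timeCoupling_deficit ((Fin.cons (glue x.1) x.2.1 : Fin (2 * L - 1 + 1) → GaugeConfig 3 L SU2) i)
    ((Fin.cons (glue x'.1) x'.2.1 : Fin (2 * L - 1 + 1) → GaugeConfig 3 L SU2) i) e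
  have h2 : 6 * (L : ℝ) ^ 3 - timeCoupling su2Rep ((Fin.cons (glue x.1) x.2.1 : Fin (2 * L - 1 + 1) → GaugeConfig 3 L SU2) i)
      ((Fin.cons (glue x'.1) x'.2.1 : Fin (2 * L - 1 + 1) → GaugeConfig 3 L SU2) i) ≤
      ∑ i : Fin (2 * L - 1 + 1), (6 * (L : ℝ) ^ 3 - timeCoupling su2Rep
        ((Fin.cons (glue x.1) x.2.1 : Fin (2 * L - 1 + 1) → GaugeConfig 3 L SU2) i)
        ((Fin.cons (glue x'.1) x'.2.1 : Fin (2 * L - 1 + 1) → GaugeConfig 3 L SU2) i)) :=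
    Finset.single_le_sum (f := fun i => 6 * (L : ℝ) ^ 3 - timeCoupling su2Rep
        ((Fin.cons (glue x.1) x.2.1 : Fin (2 * L - 1 + 1) → GaugeConfig 3 L SU2) i)
        ((Fin.cons (glue x'.1) x'.2.1 : Fin (2 * L - 1 + 1) → GaugeConfig 3 L SU2) i))
      (fun i _ => by rw [timeCoupling_deficit_eq]; positivity) (Finset.mem_univ i)
  have h3 : 0 ≤ ∑ y : Site 3 L, (2 - ((su2Rep (x.2.2 y * (x'.2.2 y)⁻¹)).trace).re) :=
    Finset.sum_nonneg fun y _ => by rw [re_trace_su2Rep_mul_inv_eq_norm]; nlinarith [norm_nonneg (su2Quat (x.2.2 y) - su2Quat (x'.2.2 y))]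
  linarith

/-- The squared chordal ring distance on `X_fix` dominates every SITE coordinate. [folklore] -/
theorem norm_sq_site_le_ringDistSq (x x' : (OffIdx L → SU2) × ((Fin (2 * L - 1) → GaugeConfig 3 L SU2) × (Site 3 L → SU2))) (y : Site 3 L) :
    ‖su2Quat (x.2.2 y) - su2Quat (x'.2.2 y)‖ ^ 2 ≤
      (∑ i : Fin (2 * L - 1 + 1), (6 * (L : ℝ) ^ 3 - timeCoupling su2Rep
        ((Fin.cons (glue x.1) x.2.1 : Fin (2 * L - 1 + 1) → GaugeConfig 3 L SU2) i)
        ((Fin.cons (glue x'.1) x'.2.1 : Fin (2 * L - 1 + 1) → GaugeConfig 3 L SU2) i))) +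
        ∑ y : Site 3 L, (2 - ((su2Rep (x.2.2 y * (x'.2.2 y)⁻¹)).trace).re) := by
  have h1 : ‖su2Quat (x.2.2 y) - su2Quat (x'.2.2 y)‖ ^ 2 ≤ ∑ y : Site 3 L, (2 - ((su2Rep (x.2.2 y * (x'.2.2 y)⁻¹)).trace).re) := by
    have e : ∀ y', 2 - ((su2Rep (x.2.2 y' * (x'.2.2 y')⁻¹)).trace).re = ‖su2Quat (x.2.2 y') - su2Quat (x'.2.2 y')‖ ^ 2 := fun y' => by
      rw [re_trace_su2Rep_mul_inv_eq_norm]; ring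
    simp only [e]
    exact Finset.single_le_sum (f := fun y' => ‖su2Quat (x.2.2 y') - su2Quat (x'.2.2 y')‖ ^ 2) (fun _ _ => by positivity) (Finset.mem_univ y)
  have h2 : 0 ≤ ∑ i : Fin (2 * L - 1 + 1), (6 * (L : ℝ) ^ 3 - timeCoupling su2Rep
        ((Fin.cons (glue x.1) x.2.1 : Fin (2 * L - 1 + 1) → GaugeConfig 3 L SU2) i)
        ((Fin.cons (glue x'.1) x'.2.1 : Fin (2 * L - 1 + 1) → GaugeConfig 3 L SU2) i)) :=
    Finset.sum_nonneg fun i _ => by rw [timeCoupling_deficit_eq]; positivity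
  linarith

/-- Conjugation is an isometry of the `su2Quat` distance, in the form `‖su2Quat(k⁻¹ u k) − su2Quat q‖ = ‖su2Quat u − su2Quat(k q k⁻¹)‖`. [folklore] -/
theorem norm_su2Quat_conj_inv_sub (k u q : SU2) : ‖su2Quat (k⁻¹ * u * k) - su2Quat q‖ = ‖su2Quat u - su2Quat (k * q * k⁻¹)‖ := by
  have hk : ‖su2Quat k‖ = 1 := norm_su2Quat k
  have hki : ‖su2Quat k⁻¹‖ = 1 := norm_su2Quat k⁻¹
  have e : su2Quat u - su2Quat (k * q * k⁻¹) = su2Quat k * (su2Quat (k⁻¹ * u * k) - su2Quat q) * su2Quat k⁻¹ := by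
    have h1 : su2Quat k * su2Quat k⁻¹ = 1 := by rw [← su2Quat_mul, mul_inv_cancel, su2Quat_one]
    rw [su2Quat_mul, su2Quat_mul, su2Quat_mul, su2Quat_mul, mul_sub, sub_mul]
    have e2 : su2Quat k * (su2Quat k⁻¹ * su2Quat u * su2Quat k) * su2Quat k⁻¹ =
        (su2Quat k * su2Quat k⁻¹) * su2Quat u * (su2Quat k * su2Quat k⁻¹) := by noncomm_ring
    rw [e2, h1, one_mul, mul_one]
  rw [e, norm_mul, norm_mul, hk, hki, one_mul, mul_one]


/-- `‖v‖² ≤ D < ρ` gives `‖v‖ ≤ √ρ`. [folklore] -/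
theorem norm_le_sqrt_of_sq_le {v : ℍ} {D ρ : ℝ} (h : ‖v‖ ^ 2 ≤ D) (hD : D < ρ) : ‖v‖ ≤ Real.sqrt ρ :=
  Real.le_sqrt_of_sq_le (by linarith)

/-! ## §2 Near a zero, a constant gauge transformation lands in the anchor slice with small coordinates -/

/-- ★★ **The anchor-slice tubes cover a metric neighbourhood of the zero set of `F_fix`.**  `L ≥ 2`, `z k₀ = true`, reference data `(λ, N₀, C₀)`
with `su2Quat C₀ = ιω_C`, `su2Quat N₀ = ιω_N` (`ω_C ⊥ ω_N` unit, `ιω_× = ιω_C ιω_N`).  If `x′ ∈ X_fix` is a zero of `F_fix` and the squared chordal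
ring distance `D(ι x, ι x′) < ρ ≤ 1/1600`, then for some sign class `s`, constant `k ∈ SU(2)` and slice coordinates `t, b₁, b₂` with `|t| < π/2`,
`|sin t| ≤ √ρ`, `b₁² + b₂² ≤ 225ρ`: the seam anchor of `k·x` is `seamSlice ω_C C₀ t`, its link anchor (wrap link `((−1,−1,−1),k₀)` of slice `0`) is
`linkSlice ω_N ω_× (centreElem(s k₀)·N₀) b₁ b₂`, and every coordinate of `k·x` is within `81√ρ` of the corresponding coordinate of `Q_s`.
[cite: Bredon1972, Ch. II §§4–5] -/
theorem exists_conj_anchorSlice_of_ringDistSq_lt (hL : 2 ≤ L) (z : Fin 3 → Bool) (hz : z ≠ fun _ => false) {k₀ : Fin 3} (hk₀ : z k₀ = true)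
    {lam : Site 3 L → SU2} (hlamc : ∀ x, lam x ∈ Subgroup.center SU2) (hlam0 : lam 0 = 1)
    (hlamflip : ∀ (x : Site 3 L) (k : Fin 3), (x k = 0 ∨ x k = -1) → lam (x.shift k) = lam x * centreElem (z k))
    (hlamstay : ∀ (x : Site 3 L) (k : Fin 3), x k ≠ 0 → x k ≠ -1 → lam (x.shift k) = lam x)
    {N₀ C₀ : SU2} (hN : (su2Quat N₀).re = 0) (hC : (su2Quat C₀).re = 0)
    (hNC : (su2Quat N₀).imI * (su2Quat C₀).imI + (su2Quat N₀).imJ * (su2Quat C₀).imJ + (su2Quat N₀).imK * (su2Quat C₀).imK = 0)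
    {ωC ωN ωX : EuclideanSpace ℝ (Fin 3)} (hCω : ‖ωC‖ = 1) (hNω : ‖ωN‖ = 1) (hCN : ⟪ωC, ωN⟫ = 0) (hX : imQuat ωX = imQuat ωC * imQuat ωN)
    (hC₀ : su2Quat C₀ = imQuat ωC) (hN₀ : su2Quat N₀ = imQuat ωN)
    (x x' : (OffIdx L → SU2) × ((Fin (2 * L - 1) → GaugeConfig 3 L SU2) × (Site 3 L → SU2)))
    (hx' : ringDeficit L z ((Fin.cons (glue x'.1) x'.2.1 : Fin (2 * L - 1 + 1) → GaugeConfig 3 L SU2), x'.2.2) = 0)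
    {ρ : ℝ} (hρ : ρ ≤ 1 / 1600)
    (hD : (∑ i : Fin (2 * L - 1 + 1), (6 * (L : ℝ) ^ 3 - timeCoupling su2Rep
        ((Fin.cons (glue x.1) x.2.1 : Fin (2 * L - 1 + 1) → GaugeConfig 3 L SU2) i)
        ((Fin.cons (glue x'.1) x'.2.1 : Fin (2 * L - 1 + 1) → GaugeConfig 3 L SU2) i))) +
        ∑ y : Site 3 L, (2 - ((su2Rep (x.2.2 y * (x'.2.2 y)⁻¹)).trace).re) < ρ) :
    ∃ (s : Fin 3 → Bool) (k : SU2) (t b₁ b₂ : ℝ), |t| < Real.pi / 2 ∧ |Real.sin t| ≤ Real.sqrt ρ ∧ b₁ ^ 2 + b₂ ^ 2 ≤ 225 * ρ ∧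
      k * x.2.2 0 * k⁻¹ = seamSlice ωC C₀ t ∧
      k * x.1 ⟨(((fun _ => (-1 : ZMod L)), k₀) : Edge 3 L), not_treeEdge_wrap hL k₀⟩ * k⁻¹ = linkSlice ωN ωX (centreElem (s k₀) * N₀) b₁ b₂ ∧
      (∀ i : OffIdx L, ‖su2Quat (k * x.1 i * k⁻¹) - su2Quat (combFlat (fun a => centreElem (s a) * (if z a then N₀ else 1)) i.1)‖ ≤ 81 * Real.sqrt ρ) ∧
      (∀ (j : Fin (2 * L - 1)) (e : Edge 3 L),
        ‖su2Quat (k * x.2.1 j e * k⁻¹) - su2Quat (combFlat (fun a => centreElem (s a) * (if z a then N₀ else 1)) e)‖ ≤ 81 * Real.sqrt ρ) ∧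
      (∀ y : Site 3 L, ‖su2Quat (k * x.2.2 y * k⁻¹) - su2Quat (lam y * C₀)‖ ≤ 81 * Real.sqrt ρ) := by
  -- the zero is a residual-`SU(2)` translate of a sign-class twist-eater
  obtain ⟨s, k', hw', hf', hg'⟩ := (ringDeficit_treeGauge_eq_zero_iff hL z hz hlamc hlam0 hlamflip hlamstay hN hC hNC x'.1 x'.2.1 x'.2.2).mp hx'
  set W : GaugeConfig 3 L SU2 := combFlat (fun a => centreElem (s a) * (if z a then N₀ else 1)) with hW
  set e₀ : Edge 3 L := (((fun _ => (-1 : ZMod L)), k₀) : Edge 3 L) with he₀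
  have he₀t : ¬ treeEdge e₀ = true := not_treeEdge_wrap hL k₀
  have hρ0 : 0 ≤ ρ := by
    have h0 : 0 ≤ (∑ i : Fin (2 * L - 1 + 1), (6 * (L : ℝ) ^ 3 - timeCoupling su2Rep
        ((Fin.cons (glue x.1) x.2.1 : Fin (2 * L - 1 + 1) → GaugeConfig 3 L SU2) i)
        ((Fin.cons (glue x'.1) x'.2.1 : Fin (2 * L - 1 + 1) → GaugeConfig 3 L SU2) i))) +
        ∑ y : Site 3 L, (2 - ((su2Rep (x.2.2 y * (x'.2.2 y)⁻¹)).trace).re) := by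
      have := norm_sq_site_le_ringDistSq x x' 0; nlinarith [sq_nonneg ‖su2Quat (x.2.2 0) - su2Quat (x'.2.2 0)‖]
    linarith
  have hsρ : Real.sqrt ρ ≤ 1 / 40 := by
    calc Real.sqrt ρ ≤ Real.sqrt (1 / 1600) := Real.sqrt_le_sqrt hρ
      _ = 1 / 40 := by rw [show (1 / 1600 : ℝ) = (1 / 40) ^ 2 by norm_num, Real.sqrt_sq (by norm_num)]
  -- the coordinates of the zero
  have hx'1 : ∀ i : OffIdx L, x'.1 i = k' * W i.1 * k'⁻¹ := by
    intro i
    have h := congrFun hw' i.1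
    rw [glue_apply_of_not_tree _ i.2] at h
    exact h
  have hx'2 : ∀ (j : Fin (2 * L - 1)) (e : Edge 3 L), x'.2.1 j e = k' * W e * k'⁻¹ := fun j e => by
    have h := congrFun (hf' j) e; exact h
  have hx'3 : ∀ y : Site 3 L, x'.2.2 y = k' * (lam y * C₀) * k'⁻¹ := fun y => congrFun hg' y
  -- per-coordinate distances `≤ √ρ` after conjugating by `k'⁻¹`
  have hdist1 : ∀ i : OffIdx L, ‖su2Quat (k'⁻¹ * x.1 i * k') - su2Quat (W i.1)‖ ≤ Real.sqrt ρ := by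
    intro i
    rw [norm_su2Quat_conj_inv_sub, ← hx'1 i]
    refine norm_le_sqrt_of_sq_le ?_ hD
    have h := norm_sq_link_le_ringDistSq x x' 0 i.1
    rw [Fin.cons_zero, Fin.cons_zero, glue_apply_of_not_tree _ i.2, glue_apply_of_not_tree _ i.2] at h
    exact h
  have hdist2 : ∀ (j : Fin (2 * L - 1)) (e : Edge 3 L), ‖su2Quat (k'⁻¹ * x.2.1 j e * k') - su2Quat (W e)‖ ≤ Real.sqrt ρ := by
    intro j e
    rw [norm_su2Quat_conj_inv_sub, ← hx'2 j e]
    refine norm_le_sqrt_of_sq_le ?_ hD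
    have h := norm_sq_link_le_ringDistSq x x' j.succ e
    rw [Fin.cons_succ, Fin.cons_succ] at h
    exact h
  have hdist3 : ∀ y : Site 3 L, ‖su2Quat (k'⁻¹ * x.2.2 y * k') - su2Quat (lam y * C₀)‖ ≤ Real.sqrt ρ := by
    intro y
    rw [norm_su2Quat_conj_inv_sub, ← hx'3 y]
    exact norm_le_sqrt_of_sq_le (norm_sq_site_le_ringDistSq x x' y) hD
  -- the anchors
  have hWe₀ : W e₀ = centreElem (s k₀) * N₀ := by
    rw [hW, combFlat_apply, if_pos (show ((fun _ => (-1 : ZMod L)) : Site 3 L) k₀ = -1 from rfl)]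
    show centreElem (s k₀) * (if z k₀ then N₀ else 1) = centreElem (s k₀) * N₀
    rw [if_pos hk₀]
  have hNs : su2Quat (centreElem (s k₀) * N₀) = imQuat ωN ∨ su2Quat (centreElem (s k₀) * N₀) = -imQuat ωN := by
    rw [su2Quat_centreElem_mul, hN₀]
    cases s k₀
    · left; simp
    · right; simp
  have h1 : ‖su2Quat (k'⁻¹ * x.2.2 0 * k') - su2Quat C₀‖ ≤ Real.sqrt ρ := by
    have h := hdist3 0; rwa [hlam0, one_mul] at h
  have h2 : ‖su2Quat (k'⁻¹ * x.1 ⟨e₀, he₀t⟩ * k') - su2Quat (centreElem (s k₀) * N₀)‖ ≤ Real.sqrt ρ := by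
    have h := hdist1 ⟨e₀, he₀t⟩; rwa [hWe₀] at h
  obtain ⟨k'', t, b₁, b₂, hk''d, htπ, hsin, hb, hseam, hlink⟩ := exists_conj_anchor_slice_su2 hCω hNω hCN hX hC₀ hNs hsρ h1 h2
  -- assemble with `k = k'' k'⁻¹`
  have hconj : ∀ u : SU2, k'' * k'⁻¹ * u * (k'' * k'⁻¹)⁻¹ = k'' * (k'⁻¹ * u * k') * k''⁻¹ := fun u => by
    rw [mul_inv_rev, inv_inv]; noncomm_ring
  have hrest : ∀ u q : SU2, ‖su2Quat (k'⁻¹ * u * k') - su2Quat q‖ ≤ Real.sqrt ρ →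
      ‖su2Quat (k'' * (k'⁻¹ * u * k') * k''⁻¹) - su2Quat q‖ ≤ 81 * Real.sqrt ρ := by
    intro u q hu
    rw [su2Quat_mul, su2Quat_mul, su2Quat_inv]
    have h := norm_conj_sub_le (norm_su2Quat k'') (norm_su2Quat (k'⁻¹ * u * k')) (su2Quat q)
    linarith
  refine ⟨s, k'' * k'⁻¹, t, b₁, b₂, htπ, hsin, by nlinarith [hb, Real.sq_sqrt hρ0], ?_, ?_, fun i => ?_, fun j e => ?_, fun y => ?_⟩
  · rw [hconj]; exact hseam
  · rw [hconj]; exact hlink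
  · rw [hconj]; exact hrest _ _ (hdist1 i)
  · rw [hconj]; exact hrest _ _ (hdist2 j e)
  · rw [hconj]; exact hrest _ _ (hdist3 y)

end Summit.QuantumFields.YangMills.Theorems.VirialFluxGap.AnchorSlice
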